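import Mathlib
import HarnessLib
import Literature.Analysis.FluidPDE.ClassicalSolution

/-!
# The W7 sub-wall rung `R0` — `TypeIQuantCubicExp` (Theorems twin of the decl of record)

Director-ns KEY-NS #188 (2) / #191 (2026-08-29): the rung Prop of line `cubic_rung`
(`Cruxes/TypeIQuantSubcubicExp/Lines/cubic_rung.lean` §1, ns-idea-7) is restated three times in the lines
`cubic_rung`, `bead_census`, `ember_census`; this module is its importable home, in the DECL-OF-RECORD namespace
`…Cruxes.TypeIQuantSubcubicExp.CubicRung` (same convention as `QuarterLogPincerQuietCoreDefs`), so that the lines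
delete their copies and import it with FQNs unchanged.  Bodies VERBATIM from `cubic_rung.lean` v1.1 (:121, :133);
`quantCubicExpAt_antitone` verbatim from `bead_census.lean` v1.2 (:99), re-homed here.  No `Theses` import (the
crux → R0 edge lives in `QuarterLogPincerCubicRungEdge`).

`QuantCubicExpAt M`: in the sup-rate Type-I frame of crux stmt-NavierStokesRegularity-24077 (Tao class on `[0,T]`,
`‖u(t,x)‖ ≤ M (T+τ−t)^{-1/2}`, `L³` history `≤ A`, `A ≥ 2`) the bound `‖u(t,x)‖ ≤ exp(K A³) t^{-1/2}` with `K = K(M)`;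
`TypeIQuantCubicExp := ∀ M, QuantCubicExpAt M` — KNOWN in the weak-`L³` gauge [BP21 Prop. 2, arXiv:2003.06717],
NOT in print in this gauge; OPEN.  Nothing here proves R0, the crux, or any summit statement. [folklore]
-/

-- the summit and its single sub-problem share the name (CONVENTIONS §1), as in every Theorems file
set_option linter.dupNamespace false

namespace Summit.NavierStokesRegularity.NavierStokesRegularity.Cruxes.TypeIQuantSubcubicExp.CubicRung

noncomputable section

open MeasureTheory Set
open scoped ENNReal NNReal
open Literature.Analysis Literature.Analysis.FluidPDE

/-- **The cubic amplification bound AT Type-I constant `M` (sup-rate gauge).**  There is `K = K(M)` such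
that every Tao-frame solution with the virtual Type-I bound `‖u(t,x)‖ ≤ M (T+τ−t)^{-1/2}` and `L³` history
`≤ A` (`A ≥ 2`) obeys `‖u(t,x)‖ ≤ exp(K A³) t^{-1/2}` — the crux's bound clause with `F(A) := exp(K A³)`.
VERBATIM from `Lines/cubic_rung.lean` :121. [corpus:paper:arxiv-2003.06717 p.10 Prop. 2 (weak-L³ gauge)] -/
def QuantCubicExpAt (M : ℝ) : Prop :=
  ∃ K : ℝ, ∀ (T τ A : ℝ) (u : ℝ → (EuclideanSpace ℝ (Fin 3)) → (EuclideanSpace ℝ (Fin 3)))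
      (p : ℝ → (EuclideanSpace ℝ (Fin 3)) → ℝ),
    (IsClassicalNSSolutionOn (Icc 0 T) 1 0 u p ∧
        ∀ n : ℕ, ∃ C : NNReal, ∀ t ∈ Icc 0 T, eLpNorm (iteratedFDeriv ℝ n (u t)) 2 volume ≤ C) →
      0 < τ →
      (∀ t ∈ Icc 0 T, ∀ x : (EuclideanSpace ℝ (Fin 3)), ‖u t x‖ ≤ M * (T + τ - t) ^ (-(1 / 2 : ℝ))) →
      (∀ t ∈ Icc 0 T, eLpNorm (u t) 3 volume ≤ ENNReal.ofReal A) → 2 ≤ A →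
      ∀ t ∈ Ioc 0 T, ∀ x : (EuclideanSpace ℝ (Fin 3)), ‖u t x‖ ≤ Real.exp (K * A ^ 3) * t ^ (-(1 / 2 : ℝ))

/-- **R0 = `TypeIQuantCubicExp`** — the rung: `log F_M(A) ≤ K_M A³` for every Type-I constant `M`, in the
crux's own (sup-rate) gauge.  VERBATIM from `Lines/cubic_rung.lean` :133.  OPEN. -/
def TypeIQuantCubicExp : Prop := ∀ M : ℝ, QuantCubicExpAt M

/-- Antitonicity in the Type-I constant: a smaller `M` is a stronger hypothesis.  VERBATIM from
`Lines/bead_census.lean` :99 (re-homed in the decl-of-record namespace). -/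
theorem quantCubicExpAt_antitone {M M' : ℝ} (hMM' : M ≤ M') (h : QuantCubicExpAt M') :
    QuantCubicExpAt M := by
  obtain ⟨K, hK⟩ := h
  refine ⟨K, fun T τ A u p hframe hτ htypeI hL3 hA t ht x => hK T τ A u p hframe hτ ?_ hL3 hA t ht x⟩
  intro s hs y
  exact (htypeI s hs y).trans
    (mul_le_mul_of_nonneg_right hMM' (Real.rpow_nonneg (by linarith [hs.2, hτ.le]) _))

end

end Summit.NavierStokesRegularity.NavierStokesRegularity.Cruxes.TypeIQuantSubcubicExp.CubicRung
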